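import Summits.HodgeConjecture.HodgeConjecture.Theorems.F0P6aRoofWInstantiationHead
import HarnessLib

/-!
# `F0P6aRoofWInstantiation` — ★ RE-HOME of `Lines/F0_P6a_RoofWInstantiation.lean` (tree ED. 2 sha16 2afdc2492f43fe94), PART 2 of 2 — tree lines :308–:458 (LAST part: the module the `Lines/` shim and consumers import; it transitively carries parts 1–1).

See PART 1 `Theorems/F0P6aRoofWInstantiationHead.lean` for the full ★ re-home header and the original module docstring (verbatim there).  Same namespace (every fully-qualified name unchanged);
the scopes open at the cut (`noncomputable section` ∕ `namespace` ∕ `section`s) are re-opened below with their `variable` ∕ `open` ∕ `set_option` ∕ `omit` ∕ `include` ∕ `universe` lines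
replayed verbatim from the tree, in order; the code after the replay block is the tree bytes :308–:458, untouched.  HC_CM is proved only modulo the 7 printed citations (2 remaining: hLiu418 = stmt-HodgeConjecture-24832, h413 = stmt-HodgeConjecture-24833) until rung 0 closes; a re-home is count-neutral.
-/

-- ── replay of the scopes open at tree line :308 (verbatim) ──
set_option autoImplicit false
set_option linter.dupNamespace false
set_option backward.isDefEq.respectTransparency false
noncomputable section
universe u
namespace Summit.HodgeConjecture.HodgeConjecture.Cruxes.HLiu418.F0P6aRoofWInstantiation
open CategoryTheory CategoryTheory.Limits AlgebraicGeometry NumberField IsDedekindDomain MulAction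
open scoped Matrix Pointwise MonoidalCategory MonObj CategoryTheory.Obj
open Literature.NumberTheory.GaloisRepresentations
open Literature.NumberTheory.Automorphic Literature.NumberTheory.Automorphic.UnitaryGroup
open Literature.AlgebraicGeometry.ShimuraVarieties.UnitaryCanonicalModel
open Literature.NumberTheory.Automorphic.Liu2021.AppendixC
open Literature.AlgebraicGeometry.Motives (AlgPoints IntegralModel SchemeOver thickening thickeningLift specOver relFrobeniusOver frobeniusTwistOver frobSpec)
open Literature.NumberTheory.DiophantineGeometry (geomResidueField specResidueField)
open Literature.AlgebraicGeometry.RelativeSpec (ActionOver)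
open Literature.AlgebraicGeometry.GroupSchemes Literature.AlgebraicGeometry.GroupSchemes.GroupSchemeKernel
open Literature.AlgebraicGeometry.GroupSchemes.AffineGroupScheme Literature.AlgebraicGeometry.GroupSchemes.TorsionLayer
open Literature.AlgebraicGeometry.AbelianSchemes Literature.AlgebraicGeometry.AbelianSchemes.AbelianSchemeOver
open Literature.AlgebraicGeometry.AbelianSchemes.AbelianSchemeOver.DualPair
open Literature.AlgebraicGeometry.AbelianSchemes.WeilPairing
open Literature.AlgebraicGeometry.AbelianSchemes.DockKernelReading
open Summit.HodgeConjecture.HodgeConjecture.Cruxes.HLiu418.F0P6aModuliDatumDefs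
open Summit.HodgeConjecture.HodgeConjecture.Cruxes.HLiu418.F0P6aRGDAssembly
open Summit.HodgeConjecture.HodgeConjecture.Cruxes.HLiu418.F0P6aDatumOfInputs
open Summit.HodgeConjecture.HodgeConjecture.Cruxes.HLiu418.F0P6bWeilCartierDuality
open Summit.HodgeConjecture.HodgeConjecture.Cruxes.HLiu418.F0P6bWDock
open Summit.HodgeConjecture.HodgeConjecture.Cruxes.HLiu418.F0P6bWeilShiftedIsotropy (e₀_comp_cartierDualMap_eq_one_of_zsmul_comp_eq_one hiso_e₀)
open Literature.NumberTheory.NumberFields (sub_one_mem_pow_sup_span)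
section Head
variable {F : Type} [Field F] [NumberField F] [IsCMField F] {ι₁ : F →+* ℂ}
    {Jstar : Matrix (Fin 2) (Fin 2) F}
    {K₀ : C5.OpenCompactSubgroup ↥(finAdelic ↥(maximalRealSubfield F) F (IsCMField.complexConj F) 2 Jstar)}
    {S : RecordSystemGS F Jstar ι₁ K₀} {hU7ₛ : S.HeckeTranslateDefinedOver}
    {hJ : (Jstar.map (IsCMField.complexConj F))ᵀ = Jstar} {hJu : IsUnit Jstar}
    {Fi : Type} [Field Fi] [Algebra F Fi] {Kc : C5.SmallLevel K₀} {G : Type} [Group G]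
    {𝓜 : IntegralModel (𝓞 F) F ((thickening F Fi).obj (S.M.obj Kc))}
    {w : HeightOneSpectrum (𝓞 F)} {hw : (IsCMField.complexConj F) • w ≠ w} {h𝓨 : (𝓜.localise w).IsSmoothProper 1}
    {θ : ActionOver (𝓜.localise w).total.hom ((Fi ≃ₐ[F] Fi) × G)}
    {e : Fi →ₐ[F] AlgebraicClosure (w.adicCompletion F)}
-- ── tree bytes :308–:458 ──

/-! ### §3 HEAD AT `x̄` — one `exact` over §2 (the package is P6b's probe §C₂; the dock is `𝔡 x̄`; `ιt := act₀Of`, `hact := rfl`) -/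

/-- `(act₀Of 𝓜 w I.univ I.act a x̄).hom.hom.hom` IS `((I.act.baseChange ι_s).baseChange x̄.left).i a` (★ `fibreHom_hom_hom_hom`, ★ `RingAction.baseChange_i`; `rfl`; twin of W2's seam).
[cite: Kottwitz1992, §5, p. 390] -/
theorem act₀Of_hom_hom_hom (I : RGDInputsAt F ι₁ Jstar K₀ S hU7ₛ hJ hJu Fi Kc G 𝓜 w hw h𝓨 θ e)
    (xbar : AlgPoints (𝓜.localise w).reductionAt (geomResidueField w)) (a : 𝓞 F) :
    (act₀Of 𝓜 w I.univ I.act a xbar).hom.hom.hom =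
      ((I.act.baseChange (pullback.fst (𝓜.localise w).total.hom (specResidueField w))).baseChange xbar.left).i a := rfl

/-- **HEAD `hlaw_w_sch₀Of` — THE `w`-BLOCK LAW AT `x̄` (W3 `hL_sch₀Of`'s `hlaw` binder at `v = w`, TOKEN FOR TOKEN).**  See the module docstring for the chain
(W-DOCK package at `x̄` ∘ `law_w_of_points` at `𝒦 := Φ𝒢` ∘ (KW) from (I-iso)+(I-rk) ∘ the bridge). [cite: MumfordAV1970, §20 (I) p. 186, §23 Thm. 2 p. 231]
[cite: Tate1997FiniteFlatGroupSchemes, §(3.8) p. 146] [cite: Liu2021, Prop. D.8 (3) pp. 136–138] -/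
theorem hlaw_w_sch₀Of (I : RGDInputsAt F ι₁ Jstar K₀ S hU7ₛ hJ hJu Fi Kc G 𝓜 w hw h𝓨 θ e) [ExpChar (geomResidueField w) I.pChar]
    [PerfectField (geomResidueField w)] [Fact I.pChar.Prime] [CharP (geomResidueField w) I.pChar]
    (𝔡 : ∀ xbar, DockAt I xbar) (xbar : AlgPoints (𝓜.localise w).reductionAt (geomResidueField w))
    -- the reduced leg of the roof: a homomorphism into an abelian scheme, with (r3₀-q) at `[p]` and (r4₀-q)
    {Bbar : AbelianSchemeOver (Spec (.of (geomResidueField w)))} (qbar : (sch₀Of 𝓜 w I.univ xbar).X ⟶ Bbar.X) [IsMonHom qbar]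
    (DB : Bbar.DualPair) (hDB : Nonempty ((Scheme.Modules.pullback DB.unitHatSlice).obj DB.P ≅ SheafOfModules.unit _))
    (lamB : Bbar.X ⟶ DB.hat.X) [IsMonHom lamB]
    (r3 : qbar ≫ lamB ≫ dualIsogenyOver qbar (dual₀Of 𝓜 w I.univ I.dual xbar) DB =
      (pol₀Of 𝓜 w I.univ I.pol xbar).lam ≫ (dual₀Of 𝓜 w I.univ I.dual xbar).hat.mulN I.pChar)
    (hr4 : ∀ a : 𝓞 F, ∃ b : Bbar.X ⟶ Bbar.X, (act₀Of 𝓜 w I.univ I.act a xbar).hom.hom.hom ≫ qbar = qbar ≫ b)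
    -- the block idempotent `εu` (`c•w`-block, level `q`) and its conjugate `ē = star εu` (`w`-block): the arithmetic rows
    (𝔠 : Ideal (𝓞 F)) (εu c : 𝓞 F) (he : εu * εu = εu + (I.pChar ^ I.fDeg) • c)
    (𝔟 : Ideal (𝓞 F)) (hp𝔟 : Ideal.span {((I.pChar : ℕ) : 𝓞 F)} = w.asIdeal * 𝔟) (hw𝔟 : w.asIdeal ⊔ 𝔟 = ⊤)
    (hē1 : RingOfIntegers.mapRingHom (cmConjRingHom F) εu - 1 ∈ w.asIdeal ^ I.fDeg)
    (hē0 : RingOfIntegers.mapRingHom (cmConjRingHom F) εu ∈ 𝔟)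
    (hεu1 : εu - 1 ∈ ((IsCMField.complexConj F) • w).asIdeal)
    (hεu0 : ∀ b ∈ ((IsCMField.complexConj F) • w).asIdeal ^ I.fDeg, b * εu ∈ Ideal.span {((I.pChar ^ I.fDeg : ℕ) : 𝓞 F)})
    (h𝔠₁ : ∀ a ∈ 𝔠, ∃ b c₁ : 𝓞 F, a * RingOfIntegers.mapRingHom (cmConjRingHom F) εu =
      ((I.pChar ^ (I.fDeg - 1) : ℕ) : 𝓞 F) * b + ((I.pChar ^ I.fDeg : ℕ) : 𝓞 F) * c₁)
    (h𝔠₂ : ∃ a ∈ 𝔠, ∃ b c₂ : 𝓞 F, ((I.pChar ^ (I.fDeg - 1) : ℕ) : 𝓞 F) * RingOfIntegers.mapRingHom (cmConjRingHom F) εu =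
      a * b + ((I.pChar ^ I.fDeg : ℕ) : 𝓞 F) * c₂)
    -- the ROOF road's kernel bound, dock clauses and saturation (W2 binders VERBATIM)
    (hkerq : ∀ ⦃T : SchemeOver (geomResidueField w)⦄ (z : T ⟶ (sch₀Of 𝓜 w I.univ xbar).X), z ≫ qbar = 1 →
      ∀ b ∈ w.asIdeal * ((IsCMField.complexConj F) • w).asIdeal, z ≫ (act₀Of 𝓜 w I.univ I.act b xbar).hom.hom.hom = 1)
    (hdock : ∀ ⦃T : SchemeOver (geomResidueField w)⦄ (t : T ⟶ (𝔡 xbar).G₀),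
      haveI := (𝔡 xbar).aff₀
      t ≫ (𝔡 xbar).ι₀G ≫ qbar = 1 ↔ ∃ s, s ≫ quotIncl (𝔡 xbar).G₀ (kerFOf I 𝔡 xbar).1 = t)
    (hF : ∀ ⦃T : SchemeOver (geomResidueField w)⦄ (t : T ⟶ (𝔡 xbar).G₀),
      t ≫ (𝔡 xbar).ι₀G ≫ relFrobeniusOver I.pChar I.fDeg (sch₀Of 𝓜 w I.univ xbar).X =
          (1 : T ⟶ ((sch₀Of 𝓜 w I.univ xbar).baseChange (frobSpec (geomResidueField w) I.pChar I.fDeg)).X) ↔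
        haveI := (𝔡 xbar).aff₀
        ∃ s, s ≫ quotIncl (𝔡 xbar).G₀ (kerFOf I 𝔡 xbar).1 = t)
    (hsat : ∀ (n : ℕ) ⦃T : SchemeOver (geomResidueField w)⦄ (x : T ⟶ (sch₀Of 𝓜 w I.univ xbar).X),
      (∀ b ∈ ((IsCMField.complexConj F) • w).asIdeal ^ n, x ≫ (act₀Of 𝓜 w I.univ I.act b xbar).hom.hom.hom = 1) →
      x ≫ relFrobeniusOver I.pChar I.fDeg (sch₀Of 𝓜 w I.univ xbar).X =
          (1 : T ⟶ ((sch₀Of 𝓜 w I.univ xbar).baseChange (frobSpec (geomResidueField w) I.pChar I.fDeg)).X) →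
      ∀ b ∈ ((IsCMField.complexConj F) • w).asIdeal, x ≫ (act₀Of 𝓜 w I.univ I.act b xbar).hom.hom.hom = 1)
    -- the two counts on the `w`-side (LA3-p03 (g3): (γ) and (k2b)), realisation-free
    (hrkw : ∀ {Z : SchemeOver (geomResidueField w)} (ζ : Z ⟶ (sch₀Of 𝓜 w I.univ xbar).X) [Mono ζ],
      (∀ ⦃T : SchemeOver (geomResidueField w)⦄ (x : T ⟶ (sch₀Of 𝓜 w I.univ xbar).X),
        (∃ z : T ⟶ Z, z ≫ ζ = x) ↔ ∀ r ∈ w.asIdeal, x ≫ (act₀Of 𝓜 w I.univ I.act r xbar).hom.hom.hom = 1) →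
      Module.finrank (geomResidueField w) (Alg Z) = I.pChar ^ I.fDeg * I.pChar ^ I.fDeg)
    (hrkN : ∀ {Z : SchemeOver (geomResidueField w)} (ζ : Z ⟶ (sch₀Of 𝓜 w I.univ xbar).X) [Mono ζ],
      (∀ ⦃T : SchemeOver (geomResidueField w)⦄ (x : T ⟶ (sch₀Of 𝓜 w I.univ xbar).X),
        (∃ z : T ⟶ Z, z ≫ ζ = x) ↔ (∀ r ∈ w.asIdeal, x ≫ (act₀Of 𝓜 w I.univ I.act r xbar).hom.hom.hom = 1) ∧ x ≫ qbar = 1) →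
      Module.finrank (geomResidueField w) (Alg Z) = I.pChar ^ I.fDeg) :
    ∀ (n : ℕ) ⦃T : SchemeOver (geomResidueField w)⦄ (x : T ⟶ (sch₀Of 𝓜 w I.univ xbar).X),
      x ≫ (sch₀Of 𝓜 w I.univ xbar).mulN (I.pChar ^ I.fDeg) = 1 →
      (∀ b ∈ w.asIdeal ^ n, x ≫ (act₀Of 𝓜 w I.univ I.act b xbar).hom.hom.hom = 1) →
      ((x ≫ relFrobeniusOver I.pChar I.fDeg (sch₀Of 𝓜 w I.univ xbar).X =
          (1 : T ⟶ ((sch₀Of 𝓜 w I.univ xbar).baseChange (frobSpec (geomResidueField w) I.pChar I.fDeg)).X)) ↔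
        ∀ a ∈ 𝔠, x ≫ (act₀Of 𝓜 w I.univ I.act a xbar).hom.hom.hom ≫ qbar = 1) := by
  haveI : Fact I.pChar.Prime := inferInstance
  letI := (𝔡 xbar).grp₀
  haveI := (𝔡 xbar).aff₀
  haveI : IsClosedImmersion (𝔡 xbar).ι₀G.left := (𝔡 xbar).hι₀G.2
  haveI : Mono (𝔡 xbar).ι₀G := Over.mono_of_mono_left _
  -- THE PACKAGE at `x̄` (P6b probe §C₂: ONE `exact wDockPackage_of_baseChange₂ …` over `I.rosati`, `I.polQuasiInv`)
  obtain ⟨d, ν, hνm, hpd, hν⟩ := I.polQuasiInv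
  haveI : IsMonHom ν := hνm
  have hstar : ∀ a : 𝓞 F, RingOfIntegers.mapRingHom (cmConjRingHom F) (RingOfIntegers.mapRingHom (cmConjRingHom F) a) = a :=
    fun a => RingOfIntegers.ext (by
      change IsCMField.complexConj F (IsCMField.complexConj F (a : F)) = (a : F)
      exact IsCMField.complexConj_apply_apply F (a : F))
  have hpkg : WDockPackage (geomResidueField w) I.pChar I.fDeg (sch₀Of 𝓜 w I.univ xbar) (dual₀Of 𝓜 w I.univ I.dual xbar)
      (pol₀Of 𝓜 w I.univ I.pol xbar) (RingOfIntegers.mapRingHom (cmConjRingHom F))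
      ((I.act.baseChange (pullback.fst (𝓜.localise w).total.hom (specResidueField w))).baseChange xbar.left) εu :=
    wDockPackage_of_baseChange₂ I.pChar I.fDeg I.univ I.dual I.pol (RingOfIntegers.mapRingHom (cmConjRingHom F)) hstar I.act
      (fun a => I.rosati a _ rfl) hpd ν hν (pullback.fst (𝓜.localise w).total.hom (specResidueField w)) xbar.left εu c he
  exact hlaw_w_of_wDockPackage I.pChar I.fDeg (one_le_fDeg I) (sch₀Of 𝓜 w I.univ xbar) (dual₀Of 𝓜 w I.univ I.dual xbar)
    (pol₀Of 𝓜 w I.univ I.pol xbar) (RingOfIntegers.mapRingHom (cmConjRingHom F))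
    ((I.act.baseChange (pullback.fst (𝓜.localise w).total.hom (specResidueField w))).baseChange xbar.left) εu hpkg
    (fun a => (act₀Of 𝓜 w I.univ I.act a xbar).hom.hom.hom) (fun a => (act₀Of_hom_hom_hom I xbar a).symm)
    w.asIdeal ((IsCMField.complexConj F) • w).asIdeal (𝔡 xbar).G₀ (𝔡 xbar).ι₀G (𝔡 xbar).hkerG₀ (kerFOf I 𝔡 xbar).1 (𝔡 xbar).hrkF₀
    qbar DB hDB lamB r3 hr4 𝔠 𝔟 hp𝔟 hw𝔟 hē1 hē0 hεu1 I.hpCharConj hεu0 h𝔠₁ h𝔠₂ hkerq hdock hF hsat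
    hrkw hrkN

/-! ### §4 THE ARITHMETIC DISCHARGED — ★ p850351 (LA1-p03 (g3), organ (W-α)): the block idempotent at level `q` and the co-ideal rows from the TWIST-NORM tokens -/

/-- **`hlaw_w_sch₀Of_of_twistNorm` — THE `w`-BLOCK LAW AT `x̄` WITH THE ARITHMETIC PAID**: §3 `hlaw_w_sch₀Of` with the block-idempotent binders
`εu c he 𝔟 hp𝔟 hw𝔟 hē1 hē0 hεu1 hεu0` produced by ★ `exists_cmBlockIdempotentAtLevel w p (I.hpChar.2) (I.hunr) (one_le_fDeg I)` and the co-ideal rows `h𝔠₁ h𝔠₂` by ★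
`frobCoideal_block_rows_of_twistNorm` from the TWIST-NORM TOKENS of the leaf (`h𝔠 : 𝔠·𝔭_w = 𝔞`, `hspec : (𝔫) = 𝔞·c𝔞`, `hnorm : 𝔫 = p^f`, `hpin : 𝔞 ⊔ 𝔭_{c•w} = ⊤` — at the W5 junction:
`𝔞 := 𝔞 γ`, `𝔠 := frobIdeal γ`, `hfrob`, `_hspec γ`, `_hnorm σ hσ γ hγ`, `(_hpin σ hσ γ hγ).1`).  Remaining binders = the dock, the leg rows, the ROOF rows, the two counts.
[cite: Neukirch1999, Ch. I §3 (3.6)] [cite: Shimura1998, §13.1 Thm. 1 (pp. 97–99)] [cite: Liu2021, Prop. D.8 (3) pp. 136–138] -/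
theorem hlaw_w_sch₀Of_of_twistNorm (I : RGDInputsAt F ι₁ Jstar K₀ S hU7ₛ hJ hJu Fi Kc G 𝓜 w hw h𝓨 θ e) [ExpChar (geomResidueField w) I.pChar]
    [PerfectField (geomResidueField w)] [Fact I.pChar.Prime] [CharP (geomResidueField w) I.pChar]
    (𝔡 : ∀ xbar, DockAt I xbar) (xbar : AlgPoints (𝓜.localise w).reductionAt (geomResidueField w))
    {Bbar : AbelianSchemeOver (Spec (.of (geomResidueField w)))} (qbar : (sch₀Of 𝓜 w I.univ xbar).X ⟶ Bbar.X) [IsMonHom qbar]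
    (DB : Bbar.DualPair) (hDB : Nonempty ((Scheme.Modules.pullback DB.unitHatSlice).obj DB.P ≅ SheafOfModules.unit _))
    (lamB : Bbar.X ⟶ DB.hat.X) [IsMonHom lamB]
    (r3 : qbar ≫ lamB ≫ dualIsogenyOver qbar (dual₀Of 𝓜 w I.univ I.dual xbar) DB =
      (pol₀Of 𝓜 w I.univ I.pol xbar).lam ≫ (dual₀Of 𝓜 w I.univ I.dual xbar).hat.mulN I.pChar)
    (hr4 : ∀ a : 𝓞 F, ∃ b : Bbar.X ⟶ Bbar.X, (act₀Of 𝓜 w I.univ I.act a xbar).hom.hom.hom ≫ qbar = qbar ≫ b)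
    -- the twist-norm tokens: `𝔠 · 𝔭_w = 𝔞`, `(𝔫) = 𝔞 · c𝔞`, `𝔫 = p^f`, `𝔞 ⊔ 𝔭_{c•w} = ⊤`
    (𝔠 𝔞 : Ideal (𝓞 F)) (𝔫 : ℕ) (h𝔠 : 𝔠 * w.asIdeal = 𝔞)
    (hspec : Ideal.span {((𝔫 : ℕ) : 𝓞 F)} = 𝔞 * (IsCMField.complexConj F) • 𝔞) (hnorm : 𝔫 = I.pChar ^ I.fDeg)
    (hpin : 𝔞 ⊔ ((IsCMField.complexConj F) • w).asIdeal = ⊤)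
    -- the ROOF road's kernel bound, dock clauses and saturation (W2 binders VERBATIM)
    (hkerq : ∀ ⦃T : SchemeOver (geomResidueField w)⦄ (z : T ⟶ (sch₀Of 𝓜 w I.univ xbar).X), z ≫ qbar = 1 →
      ∀ b ∈ w.asIdeal * ((IsCMField.complexConj F) • w).asIdeal, z ≫ (act₀Of 𝓜 w I.univ I.act b xbar).hom.hom.hom = 1)
    (hdock : ∀ ⦃T : SchemeOver (geomResidueField w)⦄ (t : T ⟶ (𝔡 xbar).G₀),
      haveI := (𝔡 xbar).aff₀
      t ≫ (𝔡 xbar).ι₀G ≫ qbar = 1 ↔ ∃ s, s ≫ quotIncl (𝔡 xbar).G₀ (kerFOf I 𝔡 xbar).1 = t)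
    (hF : ∀ ⦃T : SchemeOver (geomResidueField w)⦄ (t : T ⟶ (𝔡 xbar).G₀),
      t ≫ (𝔡 xbar).ι₀G ≫ relFrobeniusOver I.pChar I.fDeg (sch₀Of 𝓜 w I.univ xbar).X =
          (1 : T ⟶ ((sch₀Of 𝓜 w I.univ xbar).baseChange (frobSpec (geomResidueField w) I.pChar I.fDeg)).X) ↔
        haveI := (𝔡 xbar).aff₀
        ∃ s, s ≫ quotIncl (𝔡 xbar).G₀ (kerFOf I 𝔡 xbar).1 = t)
    (hsat : ∀ (n : ℕ) ⦃T : SchemeOver (geomResidueField w)⦄ (x : T ⟶ (sch₀Of 𝓜 w I.univ xbar).X),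
      (∀ b ∈ ((IsCMField.complexConj F) • w).asIdeal ^ n, x ≫ (act₀Of 𝓜 w I.univ I.act b xbar).hom.hom.hom = 1) →
      x ≫ relFrobeniusOver I.pChar I.fDeg (sch₀Of 𝓜 w I.univ xbar).X =
          (1 : T ⟶ ((sch₀Of 𝓜 w I.univ xbar).baseChange (frobSpec (geomResidueField w) I.pChar I.fDeg)).X) →
      ∀ b ∈ ((IsCMField.complexConj F) • w).asIdeal, x ≫ (act₀Of 𝓜 w I.univ I.act b xbar).hom.hom.hom = 1)
    -- the two counts on the `w`-side (W7 `hrkw_sch₀Of`, `hrkN_sch₀Of`)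
    (hrkw : ∀ {Z : SchemeOver (geomResidueField w)} (ζ : Z ⟶ (sch₀Of 𝓜 w I.univ xbar).X) [Mono ζ],
      (∀ ⦃T : SchemeOver (geomResidueField w)⦄ (x : T ⟶ (sch₀Of 𝓜 w I.univ xbar).X),
        (∃ z : T ⟶ Z, z ≫ ζ = x) ↔ ∀ r ∈ w.asIdeal, x ≫ (act₀Of 𝓜 w I.univ I.act r xbar).hom.hom.hom = 1) →
      Module.finrank (geomResidueField w) (Alg Z) = I.pChar ^ I.fDeg * I.pChar ^ I.fDeg)
    (hrkN : ∀ {Z : SchemeOver (geomResidueField w)} (ζ : Z ⟶ (sch₀Of 𝓜 w I.univ xbar).X) [Mono ζ],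
      (∀ ⦃T : SchemeOver (geomResidueField w)⦄ (x : T ⟶ (sch₀Of 𝓜 w I.univ xbar).X),
        (∃ z : T ⟶ Z, z ≫ ζ = x) ↔ (∀ r ∈ w.asIdeal, x ≫ (act₀Of 𝓜 w I.univ I.act r xbar).hom.hom.hom = 1) ∧ x ≫ qbar = 1) →
      Module.finrank (geomResidueField w) (Alg Z) = I.pChar ^ I.fDeg) :
    ∀ (n : ℕ) ⦃T : SchemeOver (geomResidueField w)⦄ (x : T ⟶ (sch₀Of 𝓜 w I.univ xbar).X),
      x ≫ (sch₀Of 𝓜 w I.univ xbar).mulN (I.pChar ^ I.fDeg) = 1 →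
      (∀ b ∈ w.asIdeal ^ n, x ≫ (act₀Of 𝓜 w I.univ I.act b xbar).hom.hom.hom = 1) →
      ((x ≫ relFrobeniusOver I.pChar I.fDeg (sch₀Of 𝓜 w I.univ xbar).X =
          (1 : T ⟶ ((sch₀Of 𝓜 w I.univ xbar).baseChange (frobSpec (geomResidueField w) I.pChar I.fDeg)).X)) ↔
        ∀ a ∈ 𝔠, x ≫ (act₀Of 𝓜 w I.univ I.act a xbar).hom.hom.hom ≫ qbar = 1) := by
  obtain ⟨εu, c, 𝔟, he, hp𝔟, hw𝔟, hē1, hē0, hεu1, hεu0, hē0f⟩ :=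
    Literature.NumberTheory.NumberFields.exists_cmBlockIdempotentAtLevel w I.pChar I.hpChar.2 I.hunr (one_le_fDeg I)
  obtain ⟨h𝔠₁, h𝔠₂⟩ := Literature.NumberTheory.NumberFields.frobCoideal_block_rows_of_twistNorm w (Fact.out : I.pChar.Prime).ne_zero hp𝔟 I.hunr hē0f
    h𝔠 hspec hnorm hpin
  exact hlaw_w_sch₀Of I 𝔡 xbar qbar DB hDB lamB r3 hr4 𝔠 εu c he 𝔟 hp𝔟 hw𝔟 hē1 hē0 hεu1 hεu0 h𝔠₁ h𝔠₂ hkerq hdock hF hsat hrkw hrkN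

end Head

end Summit.HodgeConjecture.HodgeConjecture.Cruxes.HLiu418.F0P6aRoofWInstantiation

end
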